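import Summits.Ventures.PercRepro.RankLevelSetExplicitLin2KeyQuart

/-!
# PercRepro — THE QUART KEY ROW AT `(q, p) = (16, 153 192)`, PART C: chunks 9 … 12 of 16 (p9, S4)

`proofs/SUBCLAIM-S4-p9.md` §S4.2⁗‴. The quart key `KeyQ 16 153192 d` (RankLevelSetExplicitLin2KeyQuart) at the coranks
`32785 … 49168` of the level-16 row at `p = 153 192`, by the kernel (`decide`, four chunks of
4 096); the row is assembled in RankLevelSetExplicitLin2QuartRowSixteen. Axioms: standard.
-/

namespace PercRepro

namespace ThmN

namespace Explicit

/-- The quart key row at `(q, p) = (16, 153 192)`, chunk 9 of 16: coranks `32785 … 36880`, by the kernel. -/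
theorem key_sixteen_quart_row_9 : ∀ t < 4096, KeyQ 16 153192 (17 + (32768 + t)) := by decide +kernel

/-- The quart key row at `(q, p) = (16, 153 192)`, chunk 10 of 16: coranks `36881 … 40976`, by the kernel. -/
theorem key_sixteen_quart_row_10 : ∀ t < 4096, KeyQ 16 153192 (17 + (36864 + t)) := by decide +kernel

/-- The quart key row at `(q, p) = (16, 153 192)`, chunk 11 of 16: coranks `40977 … 45072`, by the kernel. -/
theorem key_sixteen_quart_row_11 : ∀ t < 4096, KeyQ 16 153192 (17 + (40960 + t)) := by decide +kernel

/-- The quart key row at `(q, p) = (16, 153 192)`, chunk 12 of 16: coranks `45073 … 49168`, by the kernel. -/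
theorem key_sixteen_quart_row_12 : ∀ t < 4096, KeyQ 16 153192 (17 + (45056 + t)) := by decide +kernel

end Explicit

end ThmN

end PercRepro
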